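import Summits.Ventures.Crystal3D.Theorems.StickyWulffConstantPolycrystalWulffBoundInclinedLamellarSections
import Summits.Ventures.Crystal3D.Theorems.StickyWulffConstantPolycrystalWulffBoundTwinSectionShiftHolds
import Summits.Ventures.Crystal3D.Theorems.StickyWulffConstantPolycrystalWulffBoundFreeEnergyExterior

/-!
# `PolycrystalWulffBound`, line `PolyDensity`: Finset and facet plumbing for the texture form of the
# inclined-lamellar twin rung (crux `stmt-Ventures-19482`)

Route `StickyWulffConstant` of the venture `Summits/Ventures/Crystal3D`, second prover lane (poly-p2,
gen 9).  Two pieces of bookkeeping used to turn `rung_inclinedLamellar_twin_local_half`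
(`Fr + ½·sin∠·Σ_f S_f`) into a statement about the crux's energy `En`:
* `sum_offDiag_ge_sum_adjacent` — a double sum of nonnegative off-diagonal terms over `Fin (k+1)`
  dominates the sum over the ADJACENT ordered pairs `(i.castSucc, i.succ)`, `(i.succ, i.castSucc)`;
* `facetArea_neg_of_planar` — the prism area of a planar piece does not depend on the side
  (`Literature.….volume_prism_neg_eq`);
* `crossSum_eq_sum_facetArea` — the oriented cross sum of clause (B) between two cell families whose
  common-plane normals are `±ν` is the plain sum `Σ_{a,b} facetArea(Q̄_a ∩ Q̄_b) ν`.
WHAT THIS IS NOT: the texture theorem (next file); the crux is not claimed. -/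

noncomputable section

open scoped BigOperators InnerProductSpace ENNReal
open MeasureTheory Set

namespace Summit.Ventures.Crystal3D.Theorems

open Summit.Ventures.Crystal3D.Cruxes.TextureLiminf.TexShadow

/-! ### Adjacent pairs in a double sum -/

/-- A double sum of nonnegative off-diagonal terms over `Fin (k+1)` dominates the sum over the
adjacent ordered pairs. -/
theorem sum_offDiag_ge_sum_adjacent {k : ℕ} (t : Fin (k + 1) → Fin (k + 1) → ℝ)
    (ht : ∀ f g, f ≠ g → 0 ≤ t f g) :
    ∑ i : Fin k, (t i.castSucc i.succ + t i.succ i.castSucc) ≤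
      ∑ f, ∑ g, (if f = g then 0 else t f g) := by
  classical
  -- the off-diagonal sum as a sum over pairs
  set T : Fin (k + 1) × Fin (k + 1) → ℝ := fun p => if p.1 = p.2 then 0 else t p.1 p.2 with hT
  have hdouble : ∑ f, ∑ g, (if f = g then 0 else t f g) =
      ∑ p ∈ (Finset.univ : Finset (Fin (k + 1) × Fin (k + 1))), T p := by
    rw [← Finset.sum_product']
    simp [hT]
  -- the two families of adjacent pairs
  set e₁ : Fin k → Fin (k + 1) × Fin (k + 1) := fun i => (i.castSucc, i.succ) with he₁
  set e₂ : Fin k → Fin (k + 1) × Fin (k + 1) := fun i => (i.succ, i.castSucc) with he₂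
  have he₁i : Function.Injective e₁ := fun i j h => Fin.castSucc_injective _ (Prod.mk.inj h).1
  have he₂i : Function.Injective e₂ := fun i j h => Fin.succ_injective _ (Prod.mk.inj h).1
  set S₁ := (Finset.univ : Finset (Fin k)).image e₁ with hS₁
  set S₂ := (Finset.univ : Finset (Fin k)).image e₂ with hS₂
  have hdisj : Disjoint S₁ S₂ := by
    rw [Finset.disjoint_left]
    intro p hp1 hp2
    rw [hS₁, Finset.mem_image] at hp1
    rw [hS₂, Finset.mem_image] at hp2
    obtain ⟨i, -, rfl⟩ := hp1
    obtain ⟨j, -, hj⟩ := hp2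
    simp only [he₁, he₂, Prod.mk.injEq] at hj
    have h1 := congrArg Fin.val hj.1
    have h2 := congrArg Fin.val hj.2
    simp at h1 h2
    omega
  have hnonneg : ∀ p ∈ (Finset.univ : Finset (Fin (k + 1) × Fin (k + 1))), 0 ≤ T p := by
    intro p _
    simp only [hT]
    split_ifs with h
    · exact le_rfl
    · exact ht _ _ h
  have hsub : S₁ ∪ S₂ ⊆ (Finset.univ : Finset (Fin (k + 1) × Fin (k + 1))) := Finset.subset_univ _
  have hT₁ : ∀ i : Fin k, T (e₁ i) = t i.castSucc i.succ := by
    intro i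
    simp only [hT, he₁]
    rw [if_neg (show i.castSucc < i.succ from Fin.castSucc_lt_succ).ne]
  have hT₂ : ∀ i : Fin k, T (e₂ i) = t i.succ i.castSucc := by
    intro i
    simp only [hT, he₂]
    rw [if_neg (show i.castSucc < i.succ from Fin.castSucc_lt_succ).ne']
  calc ∑ i : Fin k, (t i.castSucc i.succ + t i.succ i.castSucc)
      = ∑ i : Fin k, T (e₁ i) + ∑ i : Fin k, T (e₂ i) := by
        rw [← Finset.sum_add_distrib]
        exact Finset.sum_congr rfl fun i _ => by rw [hT₁, hT₂]
    _ = ∑ p ∈ S₁, T p + ∑ p ∈ S₂, T p := by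
        rw [hS₁, hS₂, Finset.sum_image (fun i _ j _ h => he₁i h),
          Finset.sum_image (fun i _ j _ h => he₂i h)]
    _ = ∑ p ∈ S₁ ∪ S₂, T p := (Finset.sum_union hdisj).symm
    _ ≤ ∑ p ∈ (Finset.univ : Finset (Fin (k + 1) × Fin (k + 1))), T p :=
        Finset.sum_le_sum_of_subset_of_nonneg hsub fun p hp _ => hnonneg p hp
    _ = ∑ f, ∑ g, (if f = g then 0 else t f g) := hdouble.symm

/-! ### Facet areas do not depend on the side -/

/-- For a planar piece `F ⊆ {⟪ν, x⟫ = β}` (`‖ν‖ = 1`): `facetArea F (−ν) = facetArea F ν`. -/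
theorem facetArea_neg_of_planar {ν : E3} (hν : ‖ν‖ = 1) {F : Set E3} {β : ℝ}
    (hF : F ⊆ {x : E3 | ⟪ν, x⟫_ℝ = β}) : facetArea F (-ν) = facetArea F ν := by
  unfold facetArea
  obtain ⟨U, V, hU, hV, hUV, hνU, hνV⟩ := Literature.Analysis.Convexity.exists_orthonormal_pair_perp ν
  by_cases hFe : F.Nonempty
  · obtain ⟨p, hp⟩ := hFe
    have hF' : ∀ y ∈ F, ⟪ν, y⟫_ℝ = ⟪ν, p⟫_ℝ := fun y hy => by rw [hF hy, hF hp]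
    rw [Literature.Analysis.Convexity.volume_prism_neg_eq hν hU hV hUV hνU hνV hF']
  · rw [Set.not_nonempty_iff_eq_empty] at hFe
    simp [hFe]

/-- **The oriented cross sum is the plain sum of wall areas.**  For a cell family with common-plane
normals `nv` and two index sets whose mutual normals are `±ν` (`‖ν‖ = 1`):
`Σ_{a ∈ sA} Σ_{b ∈ sB} [a<b ? facetArea(Q̄_a ∩ Q̄_b)(nv a b) : facetArea(Q̄_b ∩ Q̄_a)(nv b a)]
 = Σ_{a ∈ sA} Σ_{b ∈ sB} facetArea(Q̄_a ∩ Q̄_b) ν`. -/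
theorem crossSum_eq_sum_facetArea {ν : E3} (hν : ‖ν‖ = 1) {k : ℕ} (H : Fin k → Finset (E3 × ℝ))
    (nv : Fin k → Fin k → E3)
    (hplane : ∀ j j', j ≠ j' → ‖nv j j'‖ = 1 ∧ ∃ b : ℝ,
      closure (polytope (H j)) ∩ closure (polytope (H j')) ⊆ {x | ⟪nv j j', x⟫_ℝ = b})
    {sA sB : Finset (Fin k)} (hAB : Disjoint sA sB)
    (hnvν : ∀ a ∈ sA, ∀ b ∈ sB, (nv a b = ν ∨ nv a b = -ν) ∧ (nv b a = ν ∨ nv b a = -ν)) :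
    ∑ a ∈ sA, ∑ b ∈ sB,
        (if a < b then facetArea (closure (polytope (H a)) ∩ closure (polytope (H b))) (nv a b)
          else facetArea (closure (polytope (H b)) ∩ closure (polytope (H a))) (nv b a)) =
      ∑ a ∈ sA, ∑ b ∈ sB, facetArea (closure (polytope (H a)) ∩ closure (polytope (H b))) ν := by
  refine Finset.sum_congr rfl fun a ha => Finset.sum_congr rfl fun b hb => ?_
  have hab : a ≠ b := fun h => Finset.disjoint_left.1 hAB ha (h ▸ hb)
  -- the common face is planar with respect to `ν`
  have key : ∀ (j j' : Fin k), j ≠ j' → (nv j j' = ν ∨ nv j j' = -ν) →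
      facetArea (closure (polytope (H j)) ∩ closure (polytope (H j'))) (nv j j') =
        facetArea (closure (polytope (H j)) ∩ closure (polytope (H j'))) ν := by
    intro j j' hjj' hμ
    obtain ⟨-, b₀, hb₀⟩ := hplane j j' hjj'
    rcases hμ with h | h
    · rw [h]
    · rw [h]
      rw [h] at hb₀
      have hF : closure (polytope (H j)) ∩ closure (polytope (H j')) ⊆ {x : E3 | ⟪ν, x⟫_ℝ = -b₀} := by
        intro x hx
        have := hb₀ hx
        simp only [mem_setOf_eq, inner_neg_left] at this
        show ⟪ν, x⟫_ℝ = -b₀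
        linarith
      exact facetArea_neg_of_planar hν hF
  obtain ⟨h1, h2⟩ := hnvν a ha b hb
  by_cases hlt : a < b
  · rw [if_pos hlt, key a b hab h1]
  · rw [if_neg hlt, key b a hab.symm h2, Set.inter_comm]

end Summit.Ventures.Crystal3D.Theorems

end
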